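import Literature.AlgebraicGeometry.Hyperkaehler.GeneralizedKummerTypeHodgeConjecture
import Literature.AlgebraicGeometry.Hyperkaehler.LooijengaLuntsVerbitsky
import Literature.AlgebraicGeometry.Hyperkaehler.LLVGeneration
import Literature.AlgebraicGeometry.HodgeTheory.DominatedByPowersHodgeConjecture
import Literature.AlgebraicGeometry.HodgeTheory.IsoTransport
import Literature.AlgebraicGeometry.HodgeTheory.ComplexConjugationHolds
import Literature.AlgebraicGeometry.HodgeTheory.HodgeTypeConjugation
import Mathlib.RepresentationTheory.Coinvariants
import Mathlib.RepresentationTheory.Invariants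
import Mathlib.CategoryTheory.Endomorphism
import HarnessLib

/-!
# H3 / Kum⁴ — the group `Γ(X)` and lemma node L1 (Lie generation)

Cell `hodge-kum4` (ladder HodgeAV, rung H3), namespace `Summit.Ventures.HodgeKum4`.  HONEST FRAMING: nothing
here asserts that a case of the Hodge conjecture is proved.  Every `def … : Prop` is a STATEMENT — an
obligation of the cell or a print input offered for vendoring — and every `theorem` is kernel glue
(standard axioms, no `sorry`).  H3 is a rung, not a thesis: nothing is glued to `Summit.HodgeConjecture`.
This module is one topic of the FROZEN TYPING (planner seat; semantic audit PASS 5934162d on the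
single-file form sha16 e3550acdea16baa3, of which the present files are a split by topic with no change of
any statement or proof); the INDEX is `Summits/Ventures/HodgeKum4/Statement.lean`.

## §1 The group `Γ(X)`
`autFixingH2H3 X : Subgroup (Aut X)` (p2) — automorphisms acting trivially on `H²` and `H³`;
intrinsic, no marking, no frame (for `Kum⁴`-type: the `625` translations, `Γ(X) ≅ (ℤ/5)⁴`).
`IsGammaInvariant X c` (degreewise), `gammaInvariantClasses X` (total cohomology, p1's
`invariantClasses`), bridges `ofDegree_mem_gammaInvariantClasses` / `isGammaInvariant_of_ofDegree_mem`.

## §2 L1 — Lie generation (p1).  PROOF-RISK node: sole certificate = the cell's computation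
OFFICIAL `LefschetzGenerationKum4`: for every `sl(2)`-triple `(L_ℓ, h, Λ)`,
`H*(X(ℂ); ℂ)^{Γ(X)} ⊆ ⟨H⁰, H², H³⟩_{(Λ, ∪)}` (`opCupSpan`).  Second layer: p1's frame form
`LefschetzGenerationKum4Frame` (his `LefschetzGenerationKum4`, verbatim), `IsKummerTranslationFrame`,
`frameInvariants`, the print input `KummerTranslationFrameExists`, KERNEL glue
`lefschetzGenerationKum4_of_frame`.  p1's `LieGenerationKum4` (L1°, `llvCupSpan`) and
`LieSpanLefschetzKum4` with his proved `LieGen → L1° → L1_frame` stay in `Kum4LieGeneration.lean`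
importing this file.  Grade: COMPUTED-CERT ×2 code-disjoint (kit j237456/j237580 (g0), j237941 (g2);
LOW table from j237941 only) mod ONE named print fact `MODEL_X` (FTV19 Thm 1.5 + FG03 Thm 3.10,
REFEREED) and `LooijengaLuntsVerbitsky_llvStructure_kumType` (LL97 (4.5)/GKLR22 Thm 14, REFEREED).
-/

noncomputable section

open CategoryTheory
open Literature.AlgebraicTopology.SingularHomology
open Literature.AlgebraicGeometry Literature.AlgebraicGeometry.HodgeTheory
  Literature.AlgebraicGeometry.Hyperkaehler

namespace Summit.Ventures.HodgeKum4

-- commutator bracket on `gl(H*)`, Mathlib's local-instance idiom (as in `Hyperkaehler/LooijengaLuntsVerbitsky`)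
attribute [local instance 100] LieRing.ofAssociativeRing

/-! ### §1 The group `Γ(X)` of automorphisms acting trivially on `H²` and `H³` -/

/-- **`Γ(X)`** (seat p2): the automorphisms of the `ℂ`-scheme `X` acting trivially on `H²(X(ℂ); ℂ)` and
on `H³(X(ℂ); ℂ)`, a subgroup of `Aut X`.  For `X` of `Kumⁿ`-type, `n + 1 = 5`: the translation
subgroup `(ℤ/5)⁴ ⊂ Aut₀(X) = (ℤ/5)⁴ ⋊ ℤ/2` (Boissière–Nieper-Wißkirchen–Sarti 2011; Hassett–Tschinkel
2013 Thm. 2.1; Floccari 2023 §2.5; the involution acts as `-1` on `H³`, Oguiso 2020). -/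
def autFixingH2H3 (X : Motives.SchemeOver ℂ) : Subgroup (Aut X) where
  carrier := {g | complexBetti.map g.hom 2 = 𝟙 _ ∧ complexBetti.map g.hom 3 = 𝟙 _}
  one_mem' := by
    refine ⟨?_, ?_⟩ <;> exact complexBetti.map_id _
  mul_mem' := by
    rintro g h ⟨hg2, hg3⟩ ⟨hh2, hh3⟩
    refine ⟨?_, ?_⟩
    · change complexBetti.map (h.hom ≫ g.hom) 2 = _
      rw [complexBetti.map_comp, hg2, hh2, Category.comp_id]
    · change complexBetti.map (h.hom ≫ g.hom) 3 = _
      rw [complexBetti.map_comp, hg3, hh3, Category.comp_id]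
  inv_mem' := by
    rintro g ⟨hg2, hg3⟩
    have hcomp : g.hom ≫ (g⁻¹).hom = 𝟙 X := by
      have h1 : (g⁻¹ * g).hom = (1 : Aut X).hom := by rw [inv_mul_cancel]
      exact h1
    refine ⟨?_, ?_⟩
    · have h := complexBetti.map_comp g.hom (g⁻¹).hom 2
      rw [hcomp, complexBetti.map_id, hg2, Category.comp_id] at h
      exact h.symm
    · have h := complexBetti.map_comp g.hom (g⁻¹).hom 3
      rw [hcomp, complexBetti.map_id, hg3, Category.comp_id] at h
      exact h.symm

/-- Unfolding: `g ∈ Γ(X)` iff `g^* = 1` on `H²` and on `H³`. -/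
theorem mem_autFixingH2H3_iff {X : Motives.SchemeOver ℂ} (g : Aut X) :
    g ∈ autFixingH2H3 X ↔ complexBetti.map g.hom 2 = 𝟙 _ ∧ complexBetti.map g.hom 3 = 𝟙 _ :=
  Iff.rfl

/-- A class `c ∈ Hᵏ(X(ℂ); ℂ)` is **`Γ(X)`-invariant**: `g^* c = c` for every `g ∈ Γ(X)` (degreewise form,
the one the Hodge-conjecture predicate consumes). -/
def IsGammaInvariant (X : Motives.SchemeOver ℂ) {k : ℕ} (c : complexBetti X k) : Prop :=
  ∀ g : Aut X, g ∈ autFixingH2H3 X → complexBetti.map g.hom k c = c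

/-- **`H*(X(ℂ); ℂ)^{Γ(X)}`** as a submodule of the total cohomology (seat p1's `invariantClasses` for the
family of continuous maps `g(ℂ)`, `g ∈ Γ(X)`) — the form lemma L1 is stated in. -/
def gammaInvariantClasses (X : Motives.SchemeOver ℂ) :
    Submodule ℂ (totalCohomology ℂ (Motives.ComplexPoints X)) :=
  invariantClasses ℂ
    (Set.range fun g : autFixingH2H3 X ↦ Motives.AlgPoints.mapContinuous (L := ℂ) g.val.hom)

/-- Bridge (degreewise → total): a `Γ(X)`-invariant homogeneous class is an invariant class of the
total cohomology. -/
theorem ofDegree_mem_gammaInvariantClasses {X : Motives.SchemeOver ℂ} {k : ℕ} {c : complexBetti X k}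
    (hc : IsGammaInvariant X c) :
    ofDegree ℂ (Motives.ComplexPoints X) k c ∈ gammaInvariantClasses X := by
  rw [gammaInvariantClasses, mem_invariantClasses_iff]
  rintro _ ⟨g, rfl⟩
  rw [totalPullback_lof]
  exact congrArg _ (hc g.val g.property)

/-- Bridge (total → degreewise). -/
theorem isGammaInvariant_of_ofDegree_mem {X : Motives.SchemeOver ℂ} {k : ℕ} {c : complexBetti X k}
    (hc : ofDegree ℂ (Motives.ComplexPoints X) k c ∈ gammaInvariantClasses X) :
    IsGammaInvariant X c := by
  intro g hg
  rw [gammaInvariantClasses, mem_invariantClasses_iff] at hc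
  have h := hc _ ⟨⟨g, hg⟩, rfl⟩
  rw [totalPullback_lof] at h
  simpa [ofDegree] using congrArg (DirectSum.component ℂ ℕ _ k) h

/-! ### §2 L1 — Lie generation (seat p1) -/

/-- **L1 (OFFICIAL) — Lie-generation lemma for `Kum⁴`, single-`Λ` form.**  For every smooth projective
`X` of dimension `8` of `Kum⁴`-type and every `sl(2)`-triple `(L_ℓ, h, Λ)` on `H*(X(ℂ); ℂ)` with
`ℓ ∈ H²` (`IsDualLefschetz 8 ℓ Λ`): `H*(X(ℂ); ℂ)^{Γ(X)} ⊆ ⟨H⁰, H², H³⟩_{(Λ, ∪)}` — every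
`Γ(X)`-invariant class lies in the smallest subspace containing all classes of degrees `0, 2, 3`,
closed under cup product and stable under `Λ` (`opCupSpan`).  GRADE: COMPUTED-CERT ×2 code-disjoint
(census C1/C2/odd addendum/LOW: kit j237456, j237580 (g0); j237941 (g2) — cite j237941 ONLY for the
LOW table), mod ONE named print fact `MODEL_X` (FTV19 Thm 1.5 + FG03 Thm 3.10 + BNWS11/HT13/Ehresmann,
REFEREED); GKLR22 Cor 32 organises the bookkeeping only.  Ref item G4 ("all `L_ω`, not only `L_ℓ`")
is formal here (`totalLefschetz_mem_stabilizerLie`).  In L2, `ℓ` is ample and `Λ = Λ_ℓ` algebraic by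
Foster's `B(X)`. -/
def LefschetzGenerationKum4 : Prop :=
  ∀ ⦃X : Motives.SchemeOver ℂ⦄, Motives.IsSmoothProjective 8 X → IsOfGeneralizedKummerType 4 X →
    ∀ (ℓ : complexBetti X 2) (Λ : Module.End ℂ (totalCohomology ℂ (Motives.ComplexPoints X))),
      IsDualLefschetz 8 ℓ Λ →
        gammaInvariantClasses X ≤
          opCupSpan ℂ (Motives.ComplexPoints X) Λ (degreeClasses ℂ (Motives.ComplexPoints X) {0, 2, 3})

/-- **A Kummer translation frame on `X`** (seat p1): an action `g` of `(ℤ/5)⁴` on `X` by endomorphisms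
(`g 0 = 𝟙`, `g (a + b) = g a ≫ g b` — hence automorphisms), faithful, trivial on `H²(X(ℂ); ℂ)` and on
`H³(X(ℂ); ℂ)`.  For `X` of `Kum⁴`-type its image is `Γ(X)` (at `X = K⁴(A)`: translations by `A[5]`). -/
def IsKummerTranslationFrame (X : Motives.SchemeOver ℂ) (g : (Fin 4 → ZMod 5) → (X ⟶ X)) : Prop :=
  g 0 = 𝟙 X ∧ (∀ a b, g (a + b) = g a ≫ g b) ∧ (∀ a, a ≠ 0 → g a ≠ 𝟙 X) ∧
    (∀ (a : Fin 4 → ZMod 5) (c : complexBetti X 2), complexBetti.map (g a) 2 c = c) ∧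
    (∀ (a : Fin 4 → ZMod 5) (c : complexBetti X 3), complexBetti.map (g a) 3 c = c)

/-- **`H*(X(ℂ); ℂ)^{frame}`** (seat p1) — the classes invariant under all `g_a^*`. -/
def frameInvariants (X : Motives.SchemeOver ℂ) (g : (Fin 4 → ZMod 5) → (X ⟶ X)) :
    Submodule ℂ (totalCohomology ℂ (Motives.ComplexPoints X)) :=
  invariantClasses ℂ (Set.range fun a ↦ Motives.AlgPoints.mapContinuous (L := ℂ) (g a))

/-- **L1, frame form** (seat p1's `LefschetzGenerationKum4` verbatim): for every Kummer translation frame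
`g` and every `sl(2)`-triple `(L_ℓ, h, Λ)`, `H*(X(ℂ); ℂ)^{g} ⊆ ⟨H⁰, H², H³⟩_{(Λ, ∪)}`.  This is the form
p1's kernel plan K0–K4 proves (mod `MODEL_X`). -/
def LefschetzGenerationKum4Frame : Prop :=
  ∀ ⦃X : Motives.SchemeOver ℂ⦄ (g : (Fin 4 → ZMod 5) → (X ⟶ X)),
    Motives.IsSmoothProjective 8 X → IsOfGeneralizedKummerType 4 X → IsKummerTranslationFrame X g →
      ∀ (ℓ : complexBetti X 2) (Λ : Module.End ℂ (totalCohomology ℂ (Motives.ComplexPoints X))),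
        IsDualLefschetz 8 ℓ Λ →
          frameInvariants X g ≤
            opCupSpan ℂ (Motives.ComplexPoints X) Λ (degreeClasses ℂ (Motives.ComplexPoints X) {0, 2, 3})

/-- **Frame existence (PRINT input, REFEREED): every smooth projective `Kum⁴`-type `X` carries a Kummer
translation frame** — `Aut₀(Kⁿ(A)) = A[n+1] ⋊ ⟨-1⟩` acting trivially on `H²` (Boissière–Nieper-Wißkirchen–
Sarti 2011, JMPA 95), `Aut₀` and its action are deformation invariant (Hassett–Tschinkel 2013 Thm. 2.1,
Mosc. Math. J. 13), `-1` acts as `-1` on `H³` and the translations trivially (Oguiso 2020).  Offered to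
the literature seat for vendoring (or to p1 inside `MODEL_X`). -/
def KummerTranslationFrameExists : Prop :=
  ∀ ⦃X : Motives.SchemeOver ℂ⦄, Motives.IsSmoothProjective 8 X → IsOfGeneralizedKummerType 4 X →
    ∃ g : (Fin 4 → ZMod 5) → (X ⟶ X), IsKummerTranslationFrame X g

/-- The elements of a Kummer translation frame are automorphisms in `Γ(X)`. -/
def IsKummerTranslationFrame.toAut {X : Motives.SchemeOver ℂ} {g : (Fin 4 → ZMod 5) → (X ⟶ X)}
    (hg : IsKummerTranslationFrame X g) (a : Fin 4 → ZMod 5) : Aut X where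
  hom := g a
  inv := g (-a)
  hom_inv_id := by rw [← hg.2.1, add_neg_cancel, hg.1]
  inv_hom_id := by rw [← hg.2.1, neg_add_cancel, hg.1]

/-- The automorphisms `hg.toAut a` of a Kummer translation frame lie in `Γ(X)`: a frame acts trivially on
`H²(X(ℂ); ℂ)` and on `H³(X(ℂ); ℂ)` by definition. -/
theorem IsKummerTranslationFrame.toAut_mem {X : Motives.SchemeOver ℂ} {g : (Fin 4 → ZMod 5) → (X ⟶ X)}
    (hg : IsKummerTranslationFrame X g) (a : Fin 4 → ZMod 5) : hg.toAut a ∈ autFixingH2H3 X := by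
  refine ⟨?_, ?_⟩
  · ext c; exact hg.2.2.2.1 a c
  · ext c; exact hg.2.2.2.2 a c

/-- **KERNEL glue: frame existence ∧ L1_frame ⟹ L1.**  (`Γ(X)`-invariant classes are invariant under the
image of any frame, which lies in `Γ(X)` by definition.) -/
theorem lefschetzGenerationKum4_of_frame (hex : KummerTranslationFrameExists)
    (h : LefschetzGenerationKum4Frame) : LefschetzGenerationKum4 := by
  intro X hX hK ℓ Λ hΛ v hv
  obtain ⟨g, hg⟩ := hex hX hK
  refine h g hX hK hg ℓ Λ hΛ ?_
  rw [frameInvariants, mem_invariantClasses_iff]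
  rintro _ ⟨a, rfl⟩
  rw [gammaInvariantClasses, mem_invariantClasses_iff] at hv
  exact hv _ ⟨⟨hg.toAut a, hg.toAut_mem a⟩, rfl⟩

end Summit.Ventures.HodgeKum4

end
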